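import Summits.Ventures.YMGap.Thresholds.StateLipschitz
import Summits.Ventures.YMGap.RobustBall.RobustMassGapDoorKR
import Summits.Ventures.YMGap.RobustBall.MassGapOnBall
import HarnessLib

/-!
# Venture YMGap, track ROBUST-BALL — STATE-STABILITY: every DLR state of a bounded finite-range perturbation of
# the Wilson action stays within Kantorovich–Rubinstein distance `O(oscillation load)` of the strong-coupling
# Wilson state; the state is Lipschitz across the ball in the oscillation-load seminorm

HONEST FRAMING: venture file of the cell `pub-ymgap` (QuantumFields programme), track Y2 ROBUST-BALL, seat ds-1.
Strong-coupling LATTICE statements for `SU(N)` lattice Yang–Mills on `ℤ^d` inside the ONE-LINK Dobrushin window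
of the Wilson action (`OneLinkKRModulus N R K`, `2(d−1)|β| ≤ R`, `c = 6(d−1)|β|K < 1`); Lipschitz / continuity
statements about DLR states of perturbed actions `N β S_W + W` (rb-p1's carrier `perturbedYM`); no mass-gap claim is
made here for the perturbed members, nothing about the continuum or the Clay problem.

THE THEOREM (`abs_integral_perturbed_sub_integral_le`).  Let `μ` be a Wilson DLR state at 't Hooft coupling `β` inside
the window, and let `(W, supp)` be ANY bounded measurable adapted link potential, locally finitely supported, whose
ONE-LINK OSCILLATION LOAD is `≤ ε₀` at every link (`Σ_{X ∈ supp{e}, e ∈ X} osc_X(e) ≤ ε₀`, the first load of rb-p1's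
ball `MemBallZd ε₀ ε₁ R`).  Then EVERY DLR state `ν` of the perturbed action satisfies, for every bounded local `f`
with Frobenius-Lipschitz vector `δ` on `Δ`,

  `|∫ f dν − ∫ f dμ| ≤ (√N ε₀ / (2(1 − c))) · Σ_{y ∈ Δ} δ_y`.

NO SMALLNESS of `ε₀` (and no Lipschitz load, no range bound) is needed: only the Wilson side contracts; the perturbed
side enters through its DLR equations.  So the whole family of DLR states of the perturbed actions is CONTINUOUS AT
THE WILSON POINT in the oscillation-load seminorm, uniformly in where the observable sits — the quantitative form of
«robustness of the strong-coupling state».  Corollaries: the `MemBallZd` form (`abs_integral_sub_integral_le_of_memBallZd`),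
the two-member form (`abs_integral_sub_integral_le_of_members`: any member that is itself a Dobrushin contraction
with constant `c₁` vs. any member with the same support family, bound `√N ε /(2(1 − c₁))` in the oscillation load `ε`
of the DIFFERENCE `W₁ − W₂` — the state is Lipschitz on the ball).  The hypothesis-free rows (`SU(2)`, `d = 4`:
`√2 ε₀/(2 − 9β_W)` for `0 ≤ β_W < 2/9`; every `N`: `√N ε₀ /(2(1 − 16(d−1)b₀))` for `|β| ≤ b₀ < 1/(16(d−1))`; the
two-member row on the `SU(2)` headline cell) are in the companion file `StateStabilityRows`.

MECHANISM.  `StateLipschitz.abs_integral_sub_integral_le_of_gibbs_pair` (Föllmer's Comparison Theorem (2.8) with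
defects, specialised to a Gibbs measure of a second specification) with the ONE-LINK PERTURBATION DEFECT
(`oneLink_perturbation_defect`): the one-link laws of `N β S_W` and of `N β S_W + W` at the same exterior are the
tilted Haar laws `σ^{h}` and `σ^{h − V}` (`siteLaw_ymSpecification_thooft`, rb-p1's `siteLaw_perturbedYM_thooft`,
`V(g) = H^W_{e}(η^{e←g})`), and GRÜSS'S INEQUALITY FOR TILTS (`OneLinkTiltStability.abs_integral_tilted_sub_tilted_le_of_osc`)
bounds their Kantorovich–Rubinstein distance by `osc φ · osc V / 4 ≤ (2√N L)(ε₀)/4`.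

References (mechanism; nothing cited as a named fact): H. Föllmer, LNM 1362 (1988), Ch. I, Comparison Theorem (2.8);
R. L. Dobrushin, Theory Probab. Appl. 15 (1970) §5; H.-O. Georgii, *Gibbs Measures and Phase Transitions* (2011),
Thm. 8.20, Cor. 8.23–8.24, Prop. 8.8; G. Grüss, Math. Z. 39 (1935) 215–226.
-/

noncomputable section

open MeasureTheory Function Finset ProbabilityTheory Real
open scoped NNReal
open Literature.Probability.LatticeModels
open Literature.Probability.LatticeModels.DobrushinMetric
open Literature.MathematicalPhysics.QuantumLattice
open Literature.MathematicalPhysics.QuantumFieldTheory hiding ZdEdge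
open Literature.MathematicalPhysics.QuantumFieldTheory.Balaban1983to89.StrongCouplingDobrushinWindow
open Literature.MathematicalPhysics.QuantumFieldTheory.Balaban1983to89.StrongCouplingKernelWindow
  (oneLinkKRModulus_SU)
open Summit.Ventures.YMGap.OneLinkTiltStability
open Summit.Ventures.YMGap.StateLipschitz

namespace Summit.Ventures.YMGap.RobustBall.StateStability

variable {d N : ℕ}

/-! ## §1 The one-link perturbation defect (Grüss) -/

/-- **Two tilts of the one-link Wilson law by one-link perturbations whose DIFFERENCE has oscillation `≤ ε` are
`(√N ε/2)·L`-close on `L`-Lipschitz test functions** (Kantorovich–Rubinstein, Frobenius weight): Grüss's inequality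
for tilts with `osc φ ≤ 2√N L` (`suFrobDist ≤ 2√N`). [folklore] -/
theorem abs_tilt_sub_tilt_le_of_osc_sub (B : Matrix (Fin N) (Fin N) ℂ)
    {V₁ V₂ : Matrix.specialUnitaryGroup (Fin N) ℂ → ℝ} (hV₁m : Measurable V₁) (hV₁b : ∃ C, ∀ g, |V₁ g| ≤ C)
    (hV₂m : Measurable V₂) (hV₂b : ∃ C, ∀ g, |V₂ g| ≤ C) {ε : ℝ}
    (hosc : ∀ a b, |(V₁ a - V₂ a) - (V₁ b - V₂ b)| ≤ ε)
    (φ : Matrix.specialUnitaryGroup (Fin N) ℂ → ℝ) (L : ℝ) (hφm : Measurable φ) (hφb : ∃ M, ∀ s, |φ s| ≤ M)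
    (hL : 0 ≤ L) (hφL : ∀ a b, |φ a - φ b| ≤ L * suFrobDist a b) :
    |∫ s, φ s ∂((haarProbability (Matrix.specialUnitaryGroup (Fin N) ℂ)).tilted
          fun g => (N : ℝ) * ((g : Matrix (Fin N) (Fin N) ℂ) * B).trace.re - V₁ g) -
        ∫ s, φ s ∂((haarProbability (Matrix.specialUnitaryGroup (Fin N) ℂ)).tilted
          fun g => (N : ℝ) * ((g : Matrix (Fin N) (Fin N) ℂ) * B).trace.re - V₂ g)| ≤
      Real.sqrt N * ε / 2 * L := by
  obtain ⟨hhm, hhb⟩ := su_linear_potential_measurable_bounded (N := N) B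
  obtain ⟨C₁, hC₁⟩ := hV₁b
  obtain ⟨C₂, hC₂⟩ := hV₂b
  have hU₁m : Measurable fun g : Matrix.specialUnitaryGroup (Fin N) ℂ =>
      (N : ℝ) * ((g : Matrix (Fin N) (Fin N) ℂ) * B).trace.re - V₁ g := hhm.sub hV₁m
  have hU₂m : Measurable fun g : Matrix.specialUnitaryGroup (Fin N) ℂ =>
      (N : ℝ) * ((g : Matrix (Fin N) (Fin N) ℂ) * B).trace.re - V₂ g := hhm.sub hV₂m
  have hU₁b : ∃ C, ∀ g : Matrix.specialUnitaryGroup (Fin N) ℂ,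
      |(N : ℝ) * ((g : Matrix (Fin N) (Fin N) ℂ) * B).trace.re - V₁ g| ≤ C :=
    ⟨(N : ℝ) * (Real.sqrt N * frobNorm B) + C₁, fun g => (abs_sub _ _).trans (add_le_add (hhb g) (hC₁ g))⟩
  have hU₂b : ∃ C, ∀ g : Matrix.specialUnitaryGroup (Fin N) ℂ,
      |(N : ℝ) * ((g : Matrix (Fin N) (Fin N) ℂ) * B).trace.re - V₂ g| ≤ C :=
    ⟨(N : ℝ) * (Real.sqrt N * frobNorm B) + C₂, fun g => (abs_sub _ _).trans (add_le_add (hhb g) (hC₂ g))⟩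
  have hφΩ : ∀ a b, |φ a - φ b| ≤ L * (2 * Real.sqrt N) := fun a b =>
    (hφL a b).trans (mul_le_mul_of_nonneg_left (suFrobDist_le a b) hL)
  have hW : ∀ a b : Matrix.specialUnitaryGroup (Fin N) ℂ,
      |(((N : ℝ) * ((a : Matrix (Fin N) (Fin N) ℂ) * B).trace.re - V₁ a) -
          ((N : ℝ) * ((a : Matrix (Fin N) (Fin N) ℂ) * B).trace.re - V₂ a)) -
        (((N : ℝ) * ((b : Matrix (Fin N) (Fin N) ℂ) * B).trace.re - V₁ b) -
          ((N : ℝ) * ((b : Matrix (Fin N) (Fin N) ℂ) * B).trace.re - V₂ b))| ≤ ε := fun a b => by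
    have h := hosc b a
    rw [abs_sub_comm] at h
    calc _ = |(V₁ b - V₂ b) - (V₁ a - V₂ a)| := by ring_nf
      _ ≤ ε := by rw [abs_sub_comm]; exact hosc a b
  have key := abs_integral_tilted_sub_tilted_le_of_osc
    (μ := haarProbability (Matrix.specialUnitaryGroup (Fin N) ℂ)) hU₁m hU₁b hU₂m hU₂b hφm hφb hφΩ hW
  refine key.trans (le_of_eq ?_)
  ring

/-- **One-link perturbation defect.**  For a link potential `W` with measurable terms, locally listed by `supp`, and
per-link oscillation witnesses of load `≤ ε₀` at the link `e`, the one-link conditional laws at `e` — with the SAME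
exterior `η` — of the Wilson action `N β S_W` and of the perturbed action `N β S_W + W` are within Kantorovich–Rubinstein
distance `√N ε₀ / 2` (Frobenius weight). [folklore] -/
theorem oneLink_perturbation_defect (β : ℝ) {W : Potential (ZdEdge d) (Matrix.specialUnitaryGroup (Fin N) ℂ)}
    (hWm : ∀ X, Measurable (W X)) (supp : Finset (ZdEdge d) → Finset (Finset (ZdEdge d)))
    {osc : Finset (ZdEdge d) → ZdEdge d → ℝ} (hosc : ∀ X, Dobrushin.IsOscBound (W X) (osc X)) {ε₀ : ℝ}
    (e : ZdEdge d) (hosce : ∑ X ∈ (supp {e}).filter (fun X => e ∈ X), osc X e ≤ ε₀)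
    (η : LGConfig d (Matrix.specialUnitaryGroup (Fin N) ℂ))
    (φ : Matrix.specialUnitaryGroup (Fin N) ℂ → ℝ) (L : ℝ) (hφm : Measurable φ) (hφb : ∃ M, ∀ s, |φ s| ≤ M)
    (hL : 0 ≤ L) (hφL : ∀ a b, |φ a - φ b| ≤ L * suFrobDist a b) :
    |∫ s, φ s ∂(siteLaw (ymSpecification (fundamentalRep (Fin N)) (N * β)) e η) -
        ∫ s, φ s ∂(siteLaw (perturbedYM (fundamentalRep (Fin N)) (N * β) W supp) e η)| ≤
      Real.sqrt N * ε₀ / 2 * L := by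
  classical
  rw [siteLaw_ymSpecification_thooft β e η, siteLaw_perturbedYM_thooft β hWm supp e η]
  set V : Matrix.specialUnitaryGroup (Fin N) ℂ → ℝ := fun g => hamiltonianIn W supp {e} (Function.update η e g)
    with hV
  have hVm : Measurable V := (measurable_hamiltonianIn hWm supp {e}).comp (measurable_update η)
  have hoscV : ∀ g g', V g - V g' ≤ ε₀ := fun g g' => by
    have h := hamiltonianIn_singleton_update_osc (supp := supp) hosc e η g g'
    simp only [hV]; linarith
  have hVb : ∃ C, ∀ g, |V g| ≤ C := su_exists_abs_le_of_osc hoscV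
  have h0 : (fun g : Matrix.specialUnitaryGroup (Fin N) ℂ =>
      (N : ℝ) * ((g : Matrix (Fin N) (Fin N) ℂ) * stapleField β e η).trace.re) =
      fun g : Matrix.specialUnitaryGroup (Fin N) ℂ =>
        (N : ℝ) * ((g : Matrix (Fin N) (Fin N) ℂ) * stapleField β e η).trace.re -
          (fun _ : Matrix.specialUnitaryGroup (Fin N) ℂ => (0 : ℝ)) g := by
    funext g; simp
  rw [h0]
  refine abs_tilt_sub_tilt_le_of_osc_sub (stapleField β e η) measurable_const ⟨0, fun g => by simp⟩ hVm hVb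
    (ε := ε₀) (fun a b => ?_) φ L hφm hφb hL hφL
  simp only [zero_sub, hV]
  rw [abs_le]
  constructor
  · linarith [hoscV a b]
  · linarith [hoscV b a]

/-! ## §2 Every DLR state of the perturbed action is close to the Wilson state -/

/-- **STATE-STABILITY at the Wilson point.**  `SU(N)` lattice Yang–Mills on `ℤ^d` (`d ≥ 2`, `N ≥ 2`) at 't Hooft
coupling `β` inside the one-link Dobrushin window (`OneLinkKRModulus N R K`, `2(d−1)|β| ≤ R`, `c = 6(d−1)|β|K < 1`),
and ANY bounded measurable adapted link potential `W` locally listed by `supp` with one-link oscillation load `≤ ε₀`.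
For every Wilson DLR state `μ`, every DLR state `ν` of `N β S_W + W`, and every bounded local `f` with
Frobenius-Lipschitz vector `δ` on `Δ`: `|∫ f dμ − ∫ f dν| ≤ (√N ε₀ / 2) / (1 − c) · Σ_{y∈Δ} δ_y`.  No smallness of
`ε₀`. [cite: Follmer1988, Ch. I Comparison Theorem (2.8)] -/
theorem abs_integral_sub_integral_perturbed_le (hd : 2 ≤ d) (hN : 2 ≤ N) {β R K : ℝ} (hK : 0 ≤ K)
    (hR : |β| * (2 * ((d : ℝ) - 1)) ≤ R) (hmod : OneLinkKRModulus N R K)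
    (hsmall : 6 * ((d : ℝ) - 1) * |β| * K < 1)
    {W : Potential (ZdEdge d) (Matrix.specialUnitaryGroup (Fin N) ℂ)} (hW : W.IsAdapted)
    (hWb : ∀ X, ∃ C, ∀ U, |W X U| ≤ C) {supp : Finset (ZdEdge d) → Finset (Finset (ZdEdge d))}
    (hsupp : W.IsSupportedBy supp) {osc : Finset (ZdEdge d) → ZdEdge d → ℝ}
    (hosc : ∀ X, Dobrushin.IsOscBound (W X) (osc X)) {ε₀ : ℝ}
    (hosca : ∀ e, ∑ X ∈ (supp {e}).filter (fun X => e ∈ X), osc X e ≤ ε₀)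
    {μ ν : Measure (LGConfig d (Matrix.specialUnitaryGroup (Fin N) ℂ))}
    (hμ : μ ∈ ymGibbsMeasures (d := d) (fundamentalRep (Fin N)) (N * β))
    (hν : ν ∈ perturbedGibbsMeasures (d := d) (fundamentalRep (Fin N)) (N * β) W supp)
    {f : LGConfig d (Matrix.specialUnitaryGroup (Fin N) ℂ) → ℝ} (hfm : Measurable f)
    {Δ : Finset (ZdEdge d)} (hfdep : DependsOn f (↑Δ : Set (ZdEdge d))) {M : ℝ} (hM : ∀ σ, |f σ| ≤ M)
    {δ : ZdEdge d → ℝ} (hδ : IsLipBound suFrobDist f δ) :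
    |(∫ σ, f σ ∂μ) - ∫ σ, f σ ∂ν| ≤
      Real.sqrt N * ε₀ / 2 / (1 - 6 * ((d : ℝ) - 1) * |β| * K) * ∑ y ∈ Δ, δ y := by
  classical
  haveI : SecondCountableTopology (Matrix (Fin N) (Fin N) ℂ) :=
    inferInstanceAs (SecondCountableTopology (Fin N → Fin N → ℂ))
  haveI : SecondCountableTopology (Matrix.specialUnitaryGroup (Fin N) ℂ) :=
    Topology.IsEmbedding.subtypeVal.secondCountableTopology
  have hd2 : (2 : ℝ) ≤ d := by exact_mod_cast hd
  have hd0 : (0 : ℝ) < (d : ℝ) - 1 := by linarith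
  have hd1' : 1 ≤ d := by omega
  have hN1 : 1 ≤ N := by omega
  have hWm : ∀ X, Measurable (W X) := fun X => (hW X).2
  -- the oscillation load is nonnegative (take any link)
  have hε₀ : 0 ≤ ε₀ := by
    have e₀ : ZdEdge d := (0, ⟨0, by omega⟩)
    exact (Finset.sum_nonneg fun X _ => (hosc X).nonneg e₀).trans (hosca e₀)
  set c : ℝ := 6 * ((d : ℝ) - 1) * |β| * K with hc
  have hc0 : 0 ≤ c := by positivity
  set C : ZdEdge d → ZdEdge d → ℝ := fun x y => K * |β| * linkInfluence x y with hCdef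
  have hC0 : ∀ x y, 0 ≤ C x y := fun x y => by positivity
  -- Wilson side: row sums and contraction, verbatim the tree's door `dlrMassGap_of_oneLinkKRModulus`
  have hrow : ∀ x, ∑ y ∈ linkPlaqNbr x, C x y ≤ c := by
    intro x
    simp only [hCdef]
    rw [← Finset.mul_sum]
    have hsum : ∑ y ∈ linkPlaqNbr x, (linkInfluence x y : ℝ) ≤ 6 * ((d : ℝ) - 1) := by
      have h := sum_linkInfluence_le (d := d) x
      calc ∑ y ∈ linkPlaqNbr x, (linkInfluence x y : ℝ)
          = ((∑ y ∈ linkPlaqNbr x, linkInfluence x y : ℕ) : ℝ) := by push_cast; rfl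
        _ ≤ ((6 * (d - 1) : ℕ) : ℝ) := by exact_mod_cast h
        _ = 6 * ((d : ℝ) - 1) := by push_cast [Nat.cast_sub hd1']; ring
    calc K * |β| * ∑ y ∈ linkPlaqNbr x, (linkInfluence x y : ℝ) ≤ K * |β| * (6 * ((d : ℝ) - 1)) :=
          mul_le_mul_of_nonneg_left hsum (by positivity)
      _ = c := by rw [hc]; ring
  have hcontr : ∀ (x : ZdEdge d), ∀ y ∈ linkPlaqNbr x,
      ∀ (ω η : LGConfig d (Matrix.specialUnitaryGroup (Fin N) ℂ)),
      (∀ z, z ≠ y → ω z = η z) →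
      ∀ (φ : Matrix.specialUnitaryGroup (Fin N) ℂ → ℝ) (L : ℝ), Measurable φ →
        (∃ M, ∀ s, |φ s| ≤ M) → 0 ≤ L → (∀ a b, |φ a - φ b| ≤ L * suFrobDist a b) →
        |∫ s, φ s ∂(siteLaw (ymSpecification (fundamentalRep (Fin N)) (N * β)) x ω) -
            ∫ s, φ s ∂(siteLaw (ymSpecification (fundamentalRep (Fin N)) (N * β)) x η)| ≤
          C x y * L * suFrobDist (ω y) (η y) := by
    intro x y _ ω η hωη φ L hφm hφb hL hφL
    rw [siteLaw_ymSpecification_thooft β x ω, siteLaw_ymSpecification_thooft β x η]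
    have hBω : matrixOpNorm (stapleField β x ω) ≤ R := (matrixOpNorm_stapleField_le hd1' hN1 β x ω).trans hR
    have hBη : matrixOpNorm (stapleField β x η) ≤ R := (matrixOpNorm_stapleField_le hd1' hN1 β x η).trans hR
    have key := hmod _ _ hBω hBη φ L hφm hφb hL hφL
    refine key.trans ?_
    have hdiff := frobNorm_stapleField_sub_le β x y hωη
    calc K * L * frobNorm (stapleField β x ω - stapleField β x η)
        ≤ K * L * (|β| * linkInfluence x y * suFrobDist (ω y) (η y)) :=
          mul_le_mul_of_nonneg_left hdiff (mul_nonneg hK hL)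
      _ = C x y * L * suFrobDist (ω y) (η y) := by simp only [hCdef]; ring
  have hγ : IsSpecification (ymSpecification (d := d) (fundamentalRep (Fin N)) (N * β)) :=
    isSpecification_ymSpecification_of_t2Space _ (continuous_fundamentalRep (Fin N)) _
  have hγ' : IsSpecification (perturbedYM (d := d) (fundamentalRep (Fin N)) (N * β) W supp) :=
    isSpecification_perturbedYM _ (continuous_fundamentalRep (Fin N)) _ hW hWb hsupp
  have hKR : IsKRContraction (ymSpecification (d := d) (fundamentalRep (Fin N)) (N * β)) suFrobDist
      linkPlaqNbr C :=
    isKRContraction_ymSpecification _ (continuous_fundamentalRep (Fin N)) _ hC0 hcontr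
  have hR₀ : (0 : ℝ) ≤ 2 * Real.sqrt N := by positivity
  have hμ' : IsGibbsMeasure (ymSpecification (d := d) (fundamentalRep (Fin N)) (N * β)) μ := hμ
  have hν' : IsGibbsMeasure (perturbedYM (d := d) (fundamentalRep (Fin N)) (N * β) W supp) ν := hν
  set b : ℝ := Real.sqrt N * ε₀ / 2 with hb
  have hb0 : 0 ≤ b := by positivity
  have hker : ∀ (x : ZdEdge d) (η : LGConfig d (Matrix.specialUnitaryGroup (Fin N) ℂ))
      (φ : Matrix.specialUnitaryGroup (Fin N) ℂ → ℝ) (L : ℝ), Measurable φ → (∃ M, ∀ s, |φ s| ≤ M) →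
      0 ≤ L → (∀ a a', |φ a - φ a'| ≤ L * suFrobDist a a') →
      |∫ s, φ s ∂(siteLaw (ymSpecification (fundamentalRep (Fin N)) (N * β)) x η) -
          ∫ s, φ s ∂(siteLaw (perturbedYM (fundamentalRep (Fin N)) (N * β) W supp) x η)| ≤ b * L :=
    fun x η φ L hφm hφb hL hφL => by
      simpa only [hb] using oneLink_perturbation_defect β hWm supp hosc x (hosca x) η φ L hφm hφb hL hφL
  have key := abs_integral_sub_integral_le_of_gibbs_pair hγ hγ' hKR suFrobDist_nonneg suFrobDist_le hR₀
    hc0 hsmall hrow hμ' hν' hb0 hker hfm hfdep hM hδ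
  simpa only [hb, hc] using key

/-- **`MemBallZd` form**: for every member `(W, supp)` of rb-p1's tier-1 `ℤ^d` ball `MemBallZd ε₀ ε₁ R'` (only the
oscillation radius `ε₀` enters; `ε₁`, `R'` are idle here) and every DLR state `ν` of the member, the Wilson DLR state
`μ` at a coupling inside the one-link window satisfies `|∫ f dμ − ∫ f dν| ≤ (√N ε₀/2)/(1 − c) · Σ δ(f)`.
[cite: Follmer1988, Ch. I Comparison Theorem (2.8)] -/
theorem abs_integral_sub_integral_le_of_memBallZd (hd : 2 ≤ d) (hN : 2 ≤ N) {β R K : ℝ} (hK : 0 ≤ K)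
    (hR : |β| * (2 * ((d : ℝ) - 1)) ≤ R) (hmod : OneLinkKRModulus N R K)
    (hsmall : 6 * ((d : ℝ) - 1) * |β| * K < 1) {ε₀ ε₁ R' : ℝ}
    {W : Potential (ZdEdge d) (Matrix.specialUnitaryGroup (Fin N) ℂ)}
    {supp : Finset (ZdEdge d) → Finset (Finset (ZdEdge d))} (hmem : MemBallZd ε₀ ε₁ R' W supp)
    {μ ν : Measure (LGConfig d (Matrix.specialUnitaryGroup (Fin N) ℂ))}
    (hμ : μ ∈ ymGibbsMeasures (d := d) (fundamentalRep (Fin N)) (N * β))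
    (hν : ν ∈ perturbedGibbsMeasures (d := d) (fundamentalRep (Fin N)) (N * β) W supp)
    {f : LGConfig d (Matrix.specialUnitaryGroup (Fin N) ℂ) → ℝ} (hfm : Measurable f)
    {Δ : Finset (ZdEdge d)} (hfdep : DependsOn f (↑Δ : Set (ZdEdge d))) {M : ℝ} (hM : ∀ σ, |f σ| ≤ M)
    {δ : ZdEdge d → ℝ} (hδ : IsLipBound suFrobDist f δ) :
    |(∫ σ, f σ ∂μ) - ∫ σ, f σ ∂ν| ≤
      Real.sqrt N * ε₀ / 2 / (1 - 6 * ((d : ℝ) - 1) * |β| * K) * ∑ y ∈ Δ, δ y := by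
  haveI : SecondCountableTopology (Matrix (Fin N) (Fin N) ℂ) :=
    inferInstanceAs (SecondCountableTopology (Fin N → Fin N → ℂ))
  haveI : SecondCountableTopology (Matrix.specialUnitaryGroup (Fin N) ℂ) :=
    Topology.IsEmbedding.subtypeVal.secondCountableTopology
  obtain ⟨osc, lip, hosc, -, hosca, -⟩ := hmem.loads
  have hW : W.IsAdapted := fun X => ⟨hmem.dependsOn X, (hmem.continuous X).measurable⟩
  have hWb : ∀ X, ∃ C, ∀ U, |W X U| ≤ C := fun X => exists_bound_of_continuous (hmem.continuous X)
  exact abs_integral_sub_integral_perturbed_le hd hN hK hR hmod hsmall hW hWb hmem.supportedBy hosc hosca hμ hν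
    hfm hfdep hM hδ

/-! ## §3 The state is Lipschitz across the ball: two members -/

/-- The finite-volume Hamiltonian is additive in the potential: `H^{W₁}_Λ − H^{W₂}_Λ = H^{W₁ − W₂}_Λ`. [folklore] -/
theorem hamiltonianIn_sub (W₁ W₂ : Potential (ZdEdge d) (Matrix.specialUnitaryGroup (Fin N) ℂ))
    (supp : Finset (ZdEdge d) → Finset (Finset (ZdEdge d))) (Λ : Finset (ZdEdge d))
    (σ : LGConfig d (Matrix.specialUnitaryGroup (Fin N) ℂ)) :
    hamiltonianIn W₁ supp Λ σ - hamiltonianIn W₂ supp Λ σ = hamiltonianIn (W₁ - W₂) supp Λ σ := by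
  classical
  simp only [hamiltonianIn, Pi.sub_apply, Finset.sum_sub_distrib]

/-- **STATE-STABILITY between two members — the state is Lipschitz on the ball in the oscillation-load seminorm.**
Two bounded adapted link potentials `W₁, W₂` with a COMMON local support family `supp`; the member `N β S_W + W₁` is a
Dobrushin contraction in the Vasserstein form (any door: `IsKRContraction … suFrobDist nbr C`, row sums `≤ c₁ < 1`);
the DIFFERENCE `W₁ − W₂` has one-link oscillation load `≤ ε` at every link.  Then every DLR state `ν₁` of member 1 and
every DLR state `ν₂` of member 2 satisfy `|∫ f dν₁ − ∫ f dν₂| ≤ (√N ε / 2) / (1 − c₁) · Σ δ(f)`.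
[cite: Follmer1988, Ch. I Comparison Theorem (2.8)] -/
theorem abs_integral_sub_integral_le_of_members (hd : 1 ≤ d) {β : ℝ}
    {W₁ W₂ : Potential (ZdEdge d) (Matrix.specialUnitaryGroup (Fin N) ℂ)} (hW₁ : W₁.IsAdapted)
    (hW₁b : ∀ X, ∃ C, ∀ U, |W₁ X U| ≤ C) (hW₂ : W₂.IsAdapted) (hW₂b : ∀ X, ∃ C, ∀ U, |W₂ X U| ≤ C)
    {supp : Finset (ZdEdge d) → Finset (Finset (ZdEdge d))} (hsupp₁ : W₁.IsSupportedBy supp)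
    (hsupp₂ : W₂.IsSupportedBy supp) {nbr : ZdEdge d → Finset (ZdEdge d)} {C : ZdEdge d → ZdEdge d → ℝ}
    (hKR : IsKRContraction (perturbedYM (d := d) (fundamentalRep (Fin N)) (N * β) W₁ supp) suFrobDist nbr C)
    {c₁ : ℝ} (hc0 : 0 ≤ c₁) (hc1 : c₁ < 1) (hrow : ∀ x, ∑ y ∈ nbr x, C x y ≤ c₁)
    {osc : Finset (ZdEdge d) → ZdEdge d → ℝ} (hosc : ∀ X, Dobrushin.IsOscBound ((W₁ - W₂) X) (osc X)) {ε : ℝ}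
    (hosca : ∀ e, ∑ X ∈ (supp {e}).filter (fun X => e ∈ X), osc X e ≤ ε)
    {ν₁ ν₂ : Measure (LGConfig d (Matrix.specialUnitaryGroup (Fin N) ℂ))}
    (hν₁ : ν₁ ∈ perturbedGibbsMeasures (d := d) (fundamentalRep (Fin N)) (N * β) W₁ supp)
    (hν₂ : ν₂ ∈ perturbedGibbsMeasures (d := d) (fundamentalRep (Fin N)) (N * β) W₂ supp)
    {f : LGConfig d (Matrix.specialUnitaryGroup (Fin N) ℂ) → ℝ} (hfm : Measurable f)
    {Δ : Finset (ZdEdge d)} (hfdep : DependsOn f (↑Δ : Set (ZdEdge d))) {M : ℝ} (hM : ∀ σ, |f σ| ≤ M)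
    {δ : ZdEdge d → ℝ} (hδ : IsLipBound suFrobDist f δ) :
    |(∫ σ, f σ ∂ν₁) - ∫ σ, f σ ∂ν₂| ≤ Real.sqrt N * ε / 2 / (1 - c₁) * ∑ y ∈ Δ, δ y := by
  classical
  haveI : SecondCountableTopology (Matrix (Fin N) (Fin N) ℂ) :=
    inferInstanceAs (SecondCountableTopology (Fin N → Fin N → ℂ))
  haveI : SecondCountableTopology (Matrix.specialUnitaryGroup (Fin N) ℂ) :=
    Topology.IsEmbedding.subtypeVal.secondCountableTopology
  have hW₁m : ∀ X, Measurable (W₁ X) := fun X => (hW₁ X).2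
  have hW₂m : ∀ X, Measurable (W₂ X) := fun X => (hW₂ X).2
  have hε : 0 ≤ ε := by
    have e₀ : ZdEdge d := (0, ⟨0, by omega⟩)
    exact (Finset.sum_nonneg fun X _ => (hosc X).nonneg e₀).trans (hosca e₀)
  have hγ₁ : IsSpecification (perturbedYM (d := d) (fundamentalRep (Fin N)) (N * β) W₁ supp) :=
    isSpecification_perturbedYM _ (continuous_fundamentalRep (Fin N)) _ hW₁ hW₁b hsupp₁
  have hγ₂ : IsSpecification (perturbedYM (d := d) (fundamentalRep (Fin N)) (N * β) W₂ supp) :=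
    isSpecification_perturbedYM _ (continuous_fundamentalRep (Fin N)) _ hW₂ hW₂b hsupp₂
  have hν₁' : IsGibbsMeasure (perturbedYM (d := d) (fundamentalRep (Fin N)) (N * β) W₁ supp) ν₁ := hν₁
  have hν₂' : IsGibbsMeasure (perturbedYM (d := d) (fundamentalRep (Fin N)) (N * β) W₂ supp) ν₂ := hν₂
  have hR₀ : (0 : ℝ) ≤ 2 * Real.sqrt N := by positivity
  set b : ℝ := Real.sqrt N * ε / 2 with hb
  have hb0 : 0 ≤ b := by positivity
  -- the one-link defect between the two members: Grüss on the difference of the one-link perturbations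
  have hker : ∀ (x : ZdEdge d) (η : LGConfig d (Matrix.specialUnitaryGroup (Fin N) ℂ))
      (φ : Matrix.specialUnitaryGroup (Fin N) ℂ → ℝ) (L : ℝ), Measurable φ → (∃ M, ∀ s, |φ s| ≤ M) →
      0 ≤ L → (∀ a a', |φ a - φ a'| ≤ L * suFrobDist a a') →
      |∫ s, φ s ∂(siteLaw (perturbedYM (fundamentalRep (Fin N)) (N * β) W₁ supp) x η) -
          ∫ s, φ s ∂(siteLaw (perturbedYM (fundamentalRep (Fin N)) (N * β) W₂ supp) x η)| ≤ b * L := by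
    intro x η φ L hφm hφb hL hφL
    rw [siteLaw_perturbedYM_thooft β hW₁m supp x η, siteLaw_perturbedYM_thooft β hW₂m supp x η]
    set V₁ : Matrix.specialUnitaryGroup (Fin N) ℂ → ℝ := fun g => hamiltonianIn W₁ supp {x} (Function.update η x g)
      with hV₁
    set V₂ : Matrix.specialUnitaryGroup (Fin N) ℂ → ℝ := fun g => hamiltonianIn W₂ supp {x} (Function.update η x g)
      with hV₂
    have hV₁m : Measurable V₁ := (measurable_hamiltonianIn hW₁m supp {x}).comp (measurable_update η)
    have hV₂m : Measurable V₂ := (measurable_hamiltonianIn hW₂m supp {x}).comp (measurable_update η)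
    -- each `V_i` is bounded: finitely many bounded terms
    have hVb : ∀ {W : Potential (ZdEdge d) (Matrix.specialUnitaryGroup (Fin N) ℂ)},
        (∀ X, ∃ C, ∀ U, |W X U| ≤ C) →
        ∃ C, ∀ g : Matrix.specialUnitaryGroup (Fin N) ℂ, |hamiltonianIn W supp {x} (Function.update η x g)| ≤ C := by
      intro W hWb
      choose Cb hCb using hWb
      refine ⟨∑ X ∈ (supp {x}).filter (fun X => (X ∩ {x}).Nonempty), Cb X, fun g => ?_⟩
      unfold hamiltonianIn
      exact (Finset.abs_sum_le_sum_abs _ _).trans (Finset.sum_le_sum fun X _ => hCb X _)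
    have hdiff : ∀ g, V₁ g - V₂ g = hamiltonianIn (W₁ - W₂) supp {x} (Function.update η x g) := fun g => by
      simp only [hV₁, hV₂, hamiltonianIn_sub]
    have hoscD : ∀ a a', |(V₁ a - V₂ a) - (V₁ a' - V₂ a')| ≤ ε := by
      intro a a'
      rw [hdiff, hdiff, abs_le]
      have h1 := hamiltonianIn_singleton_update_osc (supp := supp) hosc x η a a'
      have h2 := hamiltonianIn_singleton_update_osc (supp := supp) hosc x η a' a
      constructor <;> linarith [hosca x]
    have key := abs_tilt_sub_tilt_le_of_osc_sub (stapleField β x η) hV₁m (hVb hW₁b) hV₂m (hVb hW₂b) hoscD φ L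
      hφm hφb hL hφL
    simpa only [hb] using key
  have key := abs_integral_sub_integral_le_of_gibbs_pair hγ₁ hγ₂ hKR suFrobDist_nonneg suFrobDist_le hR₀
    hc0 hc1 hrow hν₁' hν₂' hb0 hker hfm hfdep hM hδ
  simpa only [hb] using key

end Summit.Ventures.YMGap.RobustBall.StateStability

end
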